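import Literature.NumberTheory.Kottwitz1992.ModuliProblemHolds
import Literature.AlgebraicGeometry.ModuliOfAbelianVarieties.Lan2013.Sec121RealStructureFirstKindHolds
import Literature.RingTheory.CentralSimple.DoubleCentralizer
import Literature.RingTheory.CentralSimple.BrauerGroupReal
import Literature.RingTheory.CentralSimple.CentralizerCornerDimensions
import Mathlib.RingTheory.MatrixAlgebra
import Mathlib.Data.Matrix.Composition
import Mathlib.RingTheory.SimpleRing.Field
import Mathlib.FieldTheory.IsAlgClosed.Basic
import Mathlib.Algebra.Module.LinearMap.Rat
import Mathlib.LinearAlgebra.Matrix.ToLin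
import HarnessLib

/-!
# [Kottwitz1992, §5 p. 391 (5.h)] «in Case D it is a product of `[F₀ : ℚ]` copies of `M_n(ℍ)`» — DISCHARGED:
# `Kottwitz1992_5_CR_caseD_holds`

Kernel-lane companion of the statement carpet ★ `Literature/NumberTheory/Kottwitz1992/ModuliProblem.lean` (squad TK; precedents ★
`ModuliProblemHolds`, ★ `ModuliProblemCasesHolds`, ★ `ModuliProblemCRCaseAHolds`): the named fact ★ `ModuliProblem.Kottwitz1992_5_CR_caseD` —
for the rational PEL datum `(B, *, V, ⟨·,·⟩, h)` of §5 in Case D (`*` of the first kind and of symplectic type on `B`) the commutant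
`C = End_B(V)` satisfies `dim_ℚ C = (2n)² [F : ℚ]` and `C_ℝ = ℝ ⊗_ℚ C ≃ₐ[ℝ] ∏_{[F₀ : ℚ]} M_n(ℍ)` for some `n ≥ 1` — is PROVED here as
`theorem Kottwitz1992_5_CR_caseD_holds : Kottwitz1992_5_CR_caseD`.  This file declares theorems only and introduces no new named fact;
cell hodgecm-mathlib, seat B-typ04 (g32); net debt −1.  HC_CM is proved only modulo the 7 printed citations (2 remaining named inputs:
hLiu418 = stmt-HodgeConjecture-24832, h413 = stmt-HodgeConjecture-24833) until rung 0 closes; this file discharges none of them.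

R. E. Kottwitz, *Points on some Shimura varieties over finite fields*, J. Amer. Math. Soc. 5 (1992), §5 p. 391 L41–L44 (held
`paper:doi-10-2307-2152772`, p0019).  THE PRINT: «Using that `*` is a positive involution and that our form `⟨·,·⟩` is skew-Hermitian,
one sees easily that in Case C the algebra `C_ℝ` is a product of `[F₀ : ℚ]` copies of `M_{2n}(ℝ)`, that in Case D it is a product of
`[F₀ : ℚ]` copies of `M_n(ℍ)`».  No proof is printed; THE PROOF GIVEN HERE (standard): §1 the centre `F = Z(B)` is a field, read on a
`Type`-small copy `K ⊆ ℂ` (the real-structure engines are stated for number fields in `Type`); `B` is central simple over `K`, `*` is a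
positive involution of the first kind (Case D: `*` is trivial on `F`), so `K` is totally real (★
`IsPositiveAntiInvolution.forall_apply_algHom_eq_iff_isTotallyReal`) and, `*` being of symplectic type (`2 dim Sym + [F:ℚ]d = [F:ℚ]d²`, i.e.
`dim_K Sym(B, *) = C(d, 2) ≠ C(d+1, 2)`), at every real embedding `σ` one has `B_σ = ℝ ⊗_{K,σ} B ≅ M_{d/2}(ℍ)` — the tree's per-place
engine ★ `Lan2013.Sec121PELLattices.exists_realModels_of_firstKind` (Lange, *Abelian Varieties over the Complex Numbers*, Thm. 2.6.5 Steps
II, V with Lemma 2.6.3, general degree); §2 `C` is central simple over `K` (★ `ModuliProblemHolds.isSimpleRing_C`, ★ `center_C_map_val`), so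
`C_σ = ℝ ⊗_{K,σ} C` is central simple over `ℝ`, `≅ M_a(ℝ)` or `M_b(ℍ)` (★ `BrauerGroupReal.exists_algEquiv_matrix_real_or_quaternion`);
§3 `V` is a `K`-vector space of dimension `N`, `B` and `C` act on it by commuting `K`-linear maps, and `[B:K][C:K] = N²` (the double
centralizer count ★ `finrank_mul_finrank_centralizer_range` in `End_ℚ(V)`, Voight Prop. 7.7.8); hence the `ℝ`-algebra map
`B_σ ⊗_ℝ C_σ → M_N(ℝ)` is injective (its source is simple, ★ `IsSimpleRing.tensorProduct_of_isCentral`) and bijective by dimensions, and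
`C_σ ≅ M_a(ℝ)` would give `M_N(ℝ) ≅ M_{d/2}(ℍ) ⊗ M_a(ℝ) ≅ M_{ad/2}(ℍ)`, excluded by ★ `BrauerGroupReal.isEmpty_matrix_real_algEquiv_matrix_quaternion`
(`[ℍ] ≠ [ℝ]` in `Br(ℝ)`); so `C_σ ≅ M_n(ℍ)` with `4n² = [C:K]` at every `σ`; §4 the resulting real models `C → M_n(ℍ)` glue by ★
`exists_algEquiv_pi_of_realModels` to `ℝ ⊗_ℚ C ≃ₐ[ℝ] ∏_{w ∣ ∞} M_n(ℍ)`, the product over the `[K:ℚ] = [F₀:ℚ]` infinite places of the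
totally real `K`, reindexed by `Fin [F₀ : ℚ]`.

## References
* [Kottwitz1992] R. E. Kottwitz, Points on some Shimura varieties over finite fields, J. Amer. Math. Soc. 5 (1992) 373–444, §5 p. 391.
* [Lange2023AbelianVarietiesComplex] H. Lange, Abelian Varieties over the Complex Numbers, Springer (2023), §2.6.2 (the per-place engine).
* [Voight2021] J. Voight, Quaternion Algebras, GTM 288 (2021), §7.7 Prop. 7.7.8 (double centralizer; the tree's `DoubleCentralizer`).
* [BourbakiAlgebreVIII2012] N. Bourbaki, Algèbre VIII (2012), §15 n°4 (`Br(ℝ)`; the tree's `BrauerGroupReal`).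
-/

noncomputable section

open scoped TensorProduct Quaternion
open Module
open NumberField

namespace Literature.NumberTheory.Kottwitz1992.ModuliProblem

open Literature.RingTheory.CentralSimple
open Literature.NumberTheory.Kottwitz1992.ModuliProblemHolds
open Literature.AlgebraicGeometry.ModuliOfAbelianVarieties.Lan2013.Sec121PELLattices
  (exists_realModels_of_firstKind isRealModel_map_algEquiv isRealModel_includeRight_baseChange)

universe u v

/-! ## §1 Real models as isomorphisms `ℝ ⊗_{K,σ} F ≅ A`; the Brauer obstruction `M_N(ℝ) ≄ M_n(ℍ) ⊗ M_a(ℝ)` -/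

section RealModelEquiv

variable {K : Type} [Field K] [Algebra K ℝ] {F : Type u} [Ring F] [Algebra ℚ F] [Algebra K F]
  {A : Type*} [Ring A] [Algebra ℚ A] [Algebra ℝ A] [Algebra K A] [IsScalarTower K ℝ A]

/-- **A real model is an isomorphism `ℝ ⊗_{K,σ} F ⥲ A` in coordinates**: for a real model `j : F → A` at `σ = algebraMap K ℝ`
the `ℝ`-algebra map `r ⊗ x ↦ r · j(x)` is an isomorphism (onto since `j(F)` spans, injective by `dim_ℝ A = [F : K]`).
[cite: Lange2023AbelianVarietiesComplex, §2.6.2 Thm. 2.6.5 proof Step II (PDF p0142 L18–L21)] -/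
private theorem exists_algEquiv_of_isRealModel [Module.Finite K F] [FiniteDimensional ℝ A] {j : F →ₐ[ℚ] A}
    (hj : IsRealModel K (algebraMap K ℝ) j) :
    ∃ Φ : ℝ ⊗[K] F ≃ₐ[ℝ] A, ∀ (r : ℝ) (x : F), Φ (r ⊗ₜ[K] x) = r • j x := by
  let j' : F →ₐ[K] A :=
    { toRingHom := j.toRingHom
      commutes' := fun k => by
        change j (algebraMap K F k) = algebraMap K A k
        rw [hj.map_algebraMap, IsScalarTower.algebraMap_apply K ℝ A] }
  have hj' : ∀ x, j' x = j x := fun _ => rfl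
  let Φ₀ : ℝ ⊗[K] F →ₐ[ℝ] A :=
    Algebra.TensorProduct.lift (Algebra.ofId ℝ A) j' fun r x => Algebra.commutes r (j' x)
  have hΦ₀ : ∀ (r : ℝ) (x : F), Φ₀ (r ⊗ₜ[K] x) = r • j x := fun r x => by
    rw [Algebra.TensorProduct.lift_tmul, Algebra.ofId_apply, hj', ← Algebra.smul_def]
  have hrange : LinearMap.range Φ₀.toLinearMap = ⊤ := by
    rw [eq_top_iff, ← hj.span_range, Submodule.span_le]
    rintro _ ⟨x, rfl⟩
    exact ⟨(1 : ℝ) ⊗ₜ[K] x, by rw [AlgHom.toLinearMap_apply, hΦ₀, one_smul]⟩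
  have hsurj : Function.Surjective Φ₀ := fun y => by
    obtain ⟨x, hx⟩ := LinearMap.range_eq_top.mp hrange y
    exact ⟨x, hx⟩
  have hdim : finrank ℝ (ℝ ⊗[K] F) = finrank ℝ A := by rw [Module.finrank_baseChange, hj.finrank_eq]
  have hinj : Function.Injective Φ₀ :=
    (LinearMap.injective_iff_surjective_of_finrank_eq_finrank hdim (f := Φ₀.toLinearMap)).mpr hsurj
  exact ⟨AlgEquiv.ofBijective Φ₀ ⟨hinj, hsurj⟩, fun r x => by rw [AlgEquiv.ofBijective_apply]; exact hΦ₀ r x⟩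

end RealModelEquiv

/-- **`[ℝ] ≠ [ℍ]` in tensor form**: an `ℝ`-algebra `X ⊗_ℝ Y` with `X ≅ M_n(ℍ)` and `Y ≅ M_a(ℝ)` (`n, a ≥ 1`) is `≅ M_{an}(ℍ)`, hence
not isomorphic to any `M_N(ℝ)` (★ `BrauerGroupReal.isEmpty_matrix_real_algEquiv_matrix_quaternion`).
[cite: BourbakiAlgebreVIII2012, VIII §15 n°4 (p. A VIII.278)] -/
private theorem false_of_algEquiv_tensor_quaternion_real {X : Type*} {Y : Type*} [Ring X] [Algebra ℝ X] [Ring Y] [Algebra ℝ Y]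
    {N n a : ℕ} [NeZero N] (hn : n ≠ 0) (ha : a ≠ 0) (e : X ⊗[ℝ] Y ≃ₐ[ℝ] Matrix (Fin N) (Fin N) ℝ)
    (φ : X ≃ₐ[ℝ] Matrix (Fin n) (Fin n) ℍ[ℝ]) (ψ : Y ≃ₐ[ℝ] Matrix (Fin a) (Fin a) ℝ) : False := by
  haveI : NeZero (a * n) := ⟨mul_ne_zero ha hn⟩
  have E : Matrix (Fin N) (Fin N) ℝ ≃ₐ[ℝ] Matrix (Fin (a * n)) (Fin (a * n)) ℍ[ℝ] :=
    e.symm.trans <| (Algebra.TensorProduct.congr φ ψ).trans <|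
      (matrixEquivTensor (Fin a) ℝ (Matrix (Fin n) (Fin n) ℍ[ℝ])).symm.trans <|
      (Matrix.compAlgEquiv (Fin a) (Fin n) ℍ[ℝ] ℝ).trans (Matrix.reindexAlgEquiv ℝ ℍ[ℝ] finProdFinEquiv)
  exact (BrauerGroupReal.isEmpty_matrix_real_algEquiv_matrix_quaternion N (a * n)).false E

/-! ## §2 One real place: `ℝ ⊗_{K,σ} C ≅ M_b(ℍ)` when `(B, *)` is of symplectic type -/

section Place

variable {K : Type} [Field K] [NumberField K] [IsTotallyReal K] [Algebra K ℝ]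
  {B : Type u} [Ring B] [Algebra ℚ B] [Algebra K B] [IsScalarTower ℚ K B] [FiniteDimensional ℚ B]
  [Algebra.IsCentral K B] [IsSimpleRing B]
  {C : Type v} [Ring C] [Algebra ℚ C] [Algebra K C] [IsScalarTower ℚ K C] [FiniteDimensional ℚ C]
  [Algebra.IsCentral K C] [IsSimpleRing C]

/-- **The place-`σ` component of `C` in Case D.**  Let `B` (central simple over the totally real `K`, positive involution `* = ιK` of
the first kind and of symplectic type, `dim_K Sym(B, *) ≠ C(d+1, 2)`, `[B : K] = d²`) and `C` (central simple over `K`) map by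
`K`-algebra maps `β`, `γ` with commuting images into `M_N(K)`, `[B : K][C : K] = N²` (the double-centralizer count for
`C = End_B(V)`, `N = dim_K V`).  Then at `σ = algebraMap K ℝ`: `B_σ ≅ M_{d/2}(ℍ)` (★ `exists_realModels_of_firstKind`), `C_σ` is
central simple over `ℝ`, `B_σ ⊗_ℝ C_σ → M_N(ℝ)` is injective (simplicity) hence bijective (dimensions), so `C_σ ≅ M_a(ℝ)` would give
`M_N(ℝ) ≅ M_{d/2}(ℍ) ⊗ M_a(ℝ) ≅ M_{ad/2}(ℍ)`, impossible; hence `C_σ ≅ M_b(ℍ)` (`4b² = [C : K]`), and `c ↦ ψ(1 ⊗ c)` is a real model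
`C → M_b(ℍ)` at `σ` — «in Case D it is a product of `[F₀ : ℚ]` copies of `M_n(ℍ)»`, one place at a time.
[cite: Kottwitz1992, §5 (p. 391)] -/
private theorem exists_realModel_quaternion_of_symplecticType {ι : B →ₗ[ℚ] B} (hpos : IsPositiveAntiInvolution B ι)
    (ιK : B →ₗ[K] B) (hιK : ∀ x, ιK x = ι x) {d : ℕ} (hd : finrank K B = d * d)
    (hs : finrank K (symmSubmodule ιK) ≠ (d + 1).choose 2)
    {N : ℕ} (βM : B →ₐ[K] Matrix (Fin N) (Fin N) K) (γM : C →ₐ[K] Matrix (Fin N) (Fin N) K)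
    (hcomm : ∀ b c, βM b * γM c = γM c * βM b) (hdim : finrank K B * finrank K C = N * N) :
    ∃ b : ℕ, b ≠ 0 ∧ finrank K C = 4 * (b * b) ∧
      ∃ j : C →ₐ[ℚ] Matrix (Fin b) (Fin b) ℍ[ℝ], IsRealModel K (algebraMap K ℝ) j := by
  classical
  haveI : Module.Finite K B := Module.Finite.of_restrictScalars_finite ℚ K B
  haveI : Module.Finite K C := Module.Finite.of_restrictScalars_finite ℚ K C
  haveI : SMulCommClass K ℚ ℝ :=
    ⟨fun k q r => by rw [Algebra.smul_def, Algebra.smul_def, Algebra.smul_def, Algebra.smul_def]; ring⟩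
  -- `B_σ ≅ M_r(ℍ)`
  obtain ⟨⟨r, hr, hdr⟩, hmod⟩ := (exists_realModels_of_firstKind hpos ιK hιK hd).2 hs
  obtain ⟨jB, hjB, -⟩ := hmod r hdr
  obtain ⟨φB, -⟩ := exists_algEquiv_of_isRealModel hjB
  -- `C_σ` and `B_σ` are central simple over `ℝ`
  haveI : IsSimpleRing (ℝ ⊗[K] C) := isSimpleRing_tensorProduct (K := K) (D := C) ℝ
  haveI : Algebra.IsCentral ℝ (ℝ ⊗[K] C) :=
    Literature.NumberTheory.Automorphic.BaseChange.isCentral_baseChange (K := K) (D := C) ℝ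
  haveI : IsSimpleRing (ℝ ⊗[K] B) := isSimpleRing_tensorProduct (K := K) (D := B) ℝ
  haveI : Algebra.IsCentral ℝ (ℝ ⊗[K] B) :=
    Literature.NumberTheory.Automorphic.BaseChange.isCentral_baseChange (K := K) (D := B) ℝ
  obtain ⟨b, hb, hC⟩ := BrauerGroupReal.exists_algEquiv_matrix_real_or_quaternion (ℝ ⊗[K] C)
  -- the commuting pair `B_σ → M_N(ℝ) ← C_σ`
  let σA : Matrix (Fin N) (Fin N) K →ₐ[K] Matrix (Fin N) (Fin N) ℝ := (Algebra.ofId K ℝ).mapMatrix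
  let βR : B →ₐ[K] Matrix (Fin N) (Fin N) ℝ := σA.comp βM
  let γR : C →ₐ[K] Matrix (Fin N) (Fin N) ℝ := σA.comp γM
  have hcommR : ∀ x y, βR x * γR y = γR y * βR x := fun x y => by
    change σA (βM x) * σA (γM y) = σA (γM y) * σA (βM x)
    rw [← map_mul, hcomm, map_mul]
  let ΘB : ℝ ⊗[K] B →ₐ[ℝ] Matrix (Fin N) (Fin N) ℝ :=
    Algebra.TensorProduct.lift (Algebra.ofId ℝ _) βR fun s x => Algebra.commutes s (βR x)
  let ΘC : ℝ ⊗[K] C →ₐ[ℝ] Matrix (Fin N) (Fin N) ℝ :=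
    Algebra.TensorProduct.lift (Algebra.ofId ℝ _) γR fun s y => Algebra.commutes s (γR y)
  have hΘB : ∀ (s : ℝ) (x : B), ΘB (s ⊗ₜ[K] x) = s • βR x := fun s x => by
    rw [Algebra.TensorProduct.lift_tmul, Algebra.ofId_apply, ← Algebra.smul_def]
  have hΘC : ∀ (s : ℝ) (y : C), ΘC (s ⊗ₜ[K] y) = s • γR y := fun s y => by
    rw [Algebra.TensorProduct.lift_tmul, Algebra.ofId_apply, ← Algebra.smul_def]
  have hΘcomm : ∀ x y, ΘB x * ΘC y = ΘC y * ΘB x := by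
    intro x y
    induction x using TensorProduct.induction_on with
    | zero => rw [map_zero, zero_mul, mul_zero]
    | add x x' hx hx' => rw [map_add, add_mul, mul_add, hx, hx']
    | tmul s b =>
      induction y using TensorProduct.induction_on with
      | zero => rw [map_zero, zero_mul, mul_zero]
      | add y y' hy hy' => rw [map_add, add_mul, mul_add, hy, hy']
      | tmul t c =>
        rw [hΘB, hΘC, smul_mul_smul_comm, smul_mul_smul_comm, hcommR, mul_comm s t]
  let Θ : (ℝ ⊗[K] B) ⊗[ℝ] (ℝ ⊗[K] C) →ₐ[ℝ] Matrix (Fin N) (Fin N) ℝ :=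
    Algebra.TensorProduct.lift ΘB ΘC fun x y => hΘcomm x y
  haveI : IsSimpleRing ((ℝ ⊗[K] B) ⊗[ℝ] (ℝ ⊗[K] C)) :=
    Literature.NumberTheory.Automorphic.IsSimpleRing.tensorProduct_of_isCentral (K := ℝ) (A := ℝ ⊗[K] B) (B := ℝ ⊗[K] C)
  have hN : N ≠ 0 := by
    intro h0
    rw [h0, mul_zero] at hdim
    rcases Nat.mul_eq_zero.mp hdim with h | h
    · exact (finrank_pos (R := K) (M := B)).ne' h
    · exact (finrank_pos (R := K) (M := C)).ne' h
  haveI : NeZero N := ⟨hN⟩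
  have hinj : Function.Injective Θ := RingHom.injective Θ.toRingHom
  have hdimR : finrank ℝ ((ℝ ⊗[K] B) ⊗[ℝ] (ℝ ⊗[K] C)) = finrank ℝ (Matrix (Fin N) (Fin N) ℝ) := by
    rw [Module.finrank_tensorProduct, Module.finrank_baseChange, Module.finrank_baseChange, hdim, Module.finrank_matrix,
      Fintype.card_fin, Module.finrank_self, mul_one]
  have hsurj : Function.Surjective Θ :=
    (LinearMap.injective_iff_surjective_of_finrank_eq_finrank hdimR (f := Θ.toLinearMap)).mp hinj
  let ΘE : (ℝ ⊗[K] B) ⊗[ℝ] (ℝ ⊗[K] C) ≃ₐ[ℝ] Matrix (Fin N) (Fin N) ℝ := AlgEquiv.ofBijective Θ ⟨hinj, hsurj⟩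
  rcases hC with ⟨⟨ψ⟩⟩ | ⟨⟨ψ⟩⟩
  · exact (false_of_algEquiv_tensor_quaternion_real hr hb ΘE φB ψ).elim
  · refine ⟨b, hb, ?_, ⟨_, isRealModel_map_algEquiv isRealModel_includeRight_baseChange ψ⟩⟩
    have h := ψ.toLinearEquiv.finrank_eq
    rw [Module.finrank_baseChange, Module.finrank_matrix, Fintype.card_fin, Quaternion.finrank_eq_four] at h
    rw [h]; ring

end Place


/-! ## §3 The discharge -/

/-- `2 · C(n+1, 2) = n (n+1)`. [folklore] -/
private theorem two_mul_choose_two_succ (n : ℕ) : 2 * (n + 1).choose 2 = n * (n + 1) := by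
  have h := Nat.add_one_mul_choose_eq n 1
  rw [Nat.choose_one_right] at h
  rw [mul_comm 2, ← h, mul_comm]

/-- `End_ℚ(V) ≅ M_n(ℚ)` is a simple ring when `V ≠ 0` is finite-dimensional (private plumbing). [folklore] -/
private theorem isSimpleRing_moduleEnd {V : Type v} [AddCommGroup V] [Module ℚ V] [FiniteDimensional ℚ V] [Nontrivial V] :
    IsSimpleRing (Module.End ℚ V) := by
  have hn : 0 < finrank ℚ V := finrank_pos
  haveI : Nonempty (Fin (finrank ℚ V)) := ⟨⟨0, hn⟩⟩
  exact IsSimpleRing.of_ringEquiv (LinearMap.toMatrixAlgEquiv (Module.finBasis ℚ V)).symm.toRingEquiv inferInstance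

/-- **(5.h), Case D, PROVED**: ★ `Kottwitz1992_5_CR_caseD` holds — for the rational PEL datum of §5 in Case D,
`dim_ℚ C = (2n)² [F : ℚ]` and `ℝ ⊗_ℚ End_B(V) ≃ₐ[ℝ] ∏_{[F₀ : ℚ]} M_n(ℍ)` for some `n ≥ 1` (module docstring for the proof).
[cite: Kottwitz1992, §5 (p. 391)] -/
theorem Kottwitz1992_5_CR_caseD_holds : Kottwitz1992_5_CR_caseD.{u, v} := by
  intro B _ _ _ _ V _ _ D hD
  haveI := D.isSimpleRing
  haveI := D.finiteDimensional
  haveI := D.finiteDimensionalV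
  haveI := D.nontrivialV
  classical
  obtain ⟨hfix, d, hdimB, hSymD⟩ := hD
  /- §1 the centre `F = Z(B)` is a field; a `Type`-small copy `K ⊆ ℂ` -/
  set Z : Subalgebra ℚ B := Subalgebra.center ℚ B with hZdef
  have hZ : IsField Z :=
    MulEquiv.isField (IsSimpleRing.isField_center B)
      ({ toFun := fun x => ⟨x.1, Subring.mem_center_iff.2 (Subalgebra.mem_center_iff.1 x.2)⟩
         invFun := fun x => ⟨x.1, Subalgebra.mem_center_iff.2 (Subring.mem_center_iff.1 x.2)⟩
         left_inv := fun _ => rfl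
         right_inv := fun _ => rfl
         map_mul' := fun _ _ => rfl } : Z ≃* Subring.center B)
  letI : Field Z := hZ.toField
  haveI : FiniteDimensional ℚ Z := Module.Finite.of_injective Z.val.toLinearMap Subtype.val_injective
  have hzpos : 0 < finrank ℚ Z := finrank_pos
  let φ : Z →+* ℂ := (IsAlgClosed.lift : Z →ₐ[ℚ] ℂ).toRingHom
  obtain ⟨K, _instK, _instCZ, ⟨e⟩⟩ : ∃ (K : Type) (_ : Field K) (_ : CharZero K), Nonempty (Z ≃+* K) :=
    ⟨↥φ.fieldRange, inferInstance, inferInstance, ⟨φ.rangeRestrictFieldEquiv⟩⟩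
  let eQ : Z ≃ₐ[ℚ] K := AlgEquiv.ofRingEquiv (f := e) fun q => by
    rw [eq_ratCast (algebraMap ℚ K) q, ← eq_ratCast (e.toRingHom.comp (algebraMap ℚ Z)) q]
    rfl
  haveI : FiniteDimensional ℚ K := LinearEquiv.finiteDimensional eQ.toLinearEquiv
  haveI : NumberField K := @NumberField.mk K _ inferInstance inferInstance
  have hKZ : finrank ℚ K = finrank ℚ Z := eQ.toLinearEquiv.finrank_eq.symm
  have hK0 : 0 < finrank ℚ K := by rw [hKZ]; exact hzpos
  /- §2 `B` is a finite central simple `K`-algebra through `K ≅ F ⊆ B` -/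
  let ιB : K →+* B := (Z.val : Z →ₐ[ℚ] B).toRingHom.comp e.symm.toRingHom
  have hιB : ∀ k : K, ιB k = ((e.symm k : Z) : B) := fun _ => rfl
  have hιB_mem : ∀ k : K, ιB k ∈ Z := fun k => (e.symm k).2
  have hιBc : ∀ (k : K) (b : B), ιB k * b = b * ιB k := fun k b => (Subalgebra.mem_center_iff.1 (hιB_mem k) b).symm
  letI : Algebra K B := ιB.toAlgebra' hιBc
  have halgB : ∀ k : K, algebraMap K B k = ιB k := fun _ => rfl
  haveI : IsScalarTower ℚ K B := ⟨fun q k b => by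
    change ιB (q • k) * b = q • (ιB k * b)
    rw [map_rat_smul ιB q k, smul_mul_assoc]⟩
  haveI : Module.Finite K B := Module.Finite.of_restrictScalars_finite ℚ K B
  haveI : Algebra.IsCentral K B := ⟨fun z hz => by
    have hz' : z ∈ Z := Subalgebra.mem_center_iff.2 (Subalgebra.mem_center_iff.1 hz)
    exact Algebra.mem_bot.2 ⟨e ⟨z, hz'⟩, by rw [halgB, hιB, e.symm_apply_apply]⟩⟩
  /- §3 `*` is a positive involution of the first kind; `K` is totally real; `*` is `K`-linear -/
  obtain ⟨ι, hι⟩ : ∃ ι : B →ₗ[ℚ] B, ∀ x, ι x = star x :=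
    ⟨{ toFun := star
       map_add' := star_add
       map_smul' := fun q x => by rw [RingHom.id_apply, star_smul, star_trivial] }, fun _ => rfl⟩
  have hpos : IsPositiveAntiInvolution B ι :=
    { map_mul := fun x y => by rw [hι, hι, hι, star_mul]
      apply_apply := fun x => by rw [hι, hι, star_star]
      trace_pos := fun x hx => by
        have hx' : star x ≠ 0 := fun h0 => hx (by rw [← star_star x, h0, star_zero])
        have h := D.pos (star x) hx'
        rw [star_star] at h
        have hl : LinearMap.mulLeft ℚ (star x * x) = Algebra.lmul ℚ B (star x * x) := LinearMap.ext fun _ => rfl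
        rw [hι, Literature.NumberTheory.Automorphic.leftMulTrace_apply, ← hl]
        exact h }
  have h1 : IsOfFirstKind K B ι := fun k => by
    rw [hι, halgB]
    exact hfix _ (hιB_mem k)
  haveI : IsTotallyReal K :=
    (hpos.forall_apply_algHom_eq_iff_isTotallyReal (IsScalarTower.toAlgHom ℚ K B) (τ := LinearMap.id)
      (fun x => by simpa using h1 x)).mp (fun x => by simpa using h1 x)
  obtain ⟨ιK, hιK⟩ : ∃ ιK : B →ₗ[K] B, ∀ x, ιK x = ι x :=
    ⟨{ toFun := ι
       map_add' := fun x y => map_add ι x y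
       map_smul' := fun c x => by
         rw [RingHom.id_apply, Algebra.smul_def, Algebra.smul_def, hpos.map_mul, h1 c, Algebra.commutes] },
      fun _ => rfl⟩
  /- §4 `[B : K] = d²` and `dim_K Sym(B, *) = C(d, 2) ≠ C(d+1, 2)` (symplectic type) -/
  have htowerB : finrank ℚ B = finrank ℚ K * finrank K B := (Module.finrank_mul_finrank ℚ K B).symm
  have hdK : finrank K B = d * d := by
    apply Nat.eq_of_mul_eq_mul_left hK0
    rw [← htowerB, hdimB, hKZ, pow_two, mul_comm]
  have hd0 : 0 < d := by
    rcases Nat.eq_zero_or_pos d with h0 | h0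
    · exfalso
      rw [h0, mul_zero] at hdK
      exact (finrank_pos (R := K) (M := B)).ne' hdK
    · exact h0
  have hmem : ∀ x : B, x ∈ symmSubmodule ιK ↔ x ∈ selfAdjoint.submodule ℚ B := fun x => by
    rw [mem_symmSubmodule_iff, hιK, hι]
    exact (selfAdjoint.mem_iff (x := x)).symm
  let eS : ↥(symmSubmodule ιK) ≃ₗ[ℚ] ↥(selfAdjoint.submodule ℚ B) :=
    { toFun := fun x => ⟨(x : B), (hmem x.1).mp x.2⟩
      invFun := fun x => ⟨(x : B), (hmem x.1).mpr x.2⟩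
      map_add' := fun _ _ => rfl
      map_smul' := fun _ _ => rfl
      left_inv := fun _ => rfl
      right_inv := fun _ => rfl }
  have hsym : finrank ℚ (selfAdjoint.submodule ℚ B) = finrank ℚ K * finrank K (symmSubmodule ιK) := by
    rw [← eS.finrank_eq, Module.finrank_mul_finrank]
  have hs : finrank K (symmSubmodule ιK) ≠ (d + 1).choose 2 := by
    intro hEq
    rw [hsym, hEq, ← hKZ] at hSymD
    -- `2 [K:ℚ] C(d+1,2) + [K:ℚ] d = [K:ℚ] d²` is `[K:ℚ] (d(d+1) + d) = [K:ℚ] d²`, absurd for `d ≥ 1`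
    have h2 : finrank ℚ K * (d * (d + 1) + d) = finrank ℚ K * (d * d) := by
      rw [← two_mul_choose_two_succ, pow_two] at *
      linarith [hSymD]
    have h3 := Nat.eq_of_mul_eq_mul_left hK0 h2
    nlinarith [h3, hd0]
  /- §5 `C = End_B(V)` is a finite central simple `K`-algebra through `K ≅ F —ρ→ C` -/
  haveI : IsSimpleRing D.C := isSimpleRing_C D
  let ιZ : Z →+* D.C :=
    { toFun := fun z => ⟨D.ρ (z : B), (rho_mem_C_iff D (z : B)).2 z.2⟩
      map_one' := Subtype.ext (by simp)
      map_mul' := fun a b => Subtype.ext (by simp)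
      map_zero' := Subtype.ext (by simp)
      map_add' := fun a b => Subtype.ext (by simp) }
  let ιC : K →+* D.C := ιZ.comp e.symm.toRingHom
  have hιC : ∀ k : K, ((ιC k : D.C) : Module.End ℚ V) = D.ρ (ιB k) := fun _ => rfl
  have hιCc : ∀ (k : K) (c : D.C), ιC k * c = c * ιC k := fun k c => by
    apply Subtype.ext
    have hc : (c : Module.End ℚ V) ∈ Subalgebra.centralizer ℚ (Set.range D.ρ) := c.2
    rw [Subalgebra.mem_centralizer_iff] at hc
    change (ιC k : Module.End ℚ V) * c = c * (ιC k : Module.End ℚ V)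
    rw [hιC]
    exact hc _ ⟨_, rfl⟩
  letI : Algebra K D.C := ιC.toAlgebra' hιCc
  have halgC : ∀ k : K, algebraMap K D.C k = ιC k := fun _ => rfl
  haveI : IsScalarTower ℚ K D.C := ⟨fun q k c => by
    change ιC (q • k) * c = q • (ιC k * c)
    rw [map_rat_smul ιC q k, smul_mul_assoc]⟩
  haveI : Module.Finite ℚ D.C := Module.Finite.of_injective D.C.val.toLinearMap Subtype.val_injective
  haveI : Module.Finite K D.C := Module.Finite.of_restrictScalars_finite ℚ K D.C
  haveI : Algebra.IsCentral K D.C := ⟨fun c hc => by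
    rw [Subalgebra.mem_center_iff] at hc
    have hc' : (c : Module.End ℚ V) ∈ (Subalgebra.center ℚ D.C).map D.C.val :=
      Subalgebra.mem_map.2 ⟨c, Subalgebra.mem_center_iff.2 hc, rfl⟩
    rw [center_C_map_val D, Subalgebra.mem_map] at hc'
    obtain ⟨b, hb, hbc⟩ := hc'
    refine Algebra.mem_bot.2 ⟨e ⟨b, hb⟩, Subtype.ext ?_⟩
    rw [halgC, hιC, hιB, e.symm_apply_apply, hbc]⟩
  /- §6 `V` as a `K`-vector space; `B` and `C` act by commuting `K`-linear maps; `[B:K][C:K] = N²` -/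
  letI : Module K V := Module.compHom V ((D.ρ : B →+* Module.End ℚ V).comp ιB)
  have hsmulV : ∀ (k : K) (x : V), k • x = D.ρ (ιB k) x := fun _ _ => rfl
  haveI : IsScalarTower ℚ K V := ⟨fun q k x => by
    rw [hsmulV, hsmulV, map_rat_smul ιB q k, map_smul, LinearMap.smul_apply]⟩
  haveI : Module.Finite K V := Module.Finite.of_restrictScalars_finite ℚ K V
  have hρK : ∀ (b : B) (k : K) (x : V), D.ρ b (k • x) = k • D.ρ b x := fun b k x => by
    rw [hsmulV, hsmulV, ← Module.End.mul_apply, ← map_mul, ← hιBc, map_mul, Module.End.mul_apply]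
  have hcK : ∀ (c : D.C) (k : K) (x : V), (c : Module.End ℚ V) (k • x) = k • (c : Module.End ℚ V) x := fun c k x => by
    have hc := (Subalgebra.mem_centralizer_iff ℚ).1 c.2 (D.ρ (ιB k)) ⟨_, rfl⟩
    rw [hsmulV, hsmulV, ← Module.End.mul_apply, ← hc, Module.End.mul_apply]
  let βE : B →ₐ[K] Module.End K V :=
    { toFun := fun b =>
        { toFun := fun x => D.ρ b x
          map_add' := fun x y => map_add _ x y
          map_smul' := fun k x => hρK b k x }
      map_one' := LinearMap.ext fun x => by simp
      map_mul' := fun a b => LinearMap.ext fun x => by simp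
      map_zero' := LinearMap.ext fun x => by simp
      map_add' := fun a b => LinearMap.ext fun x => by simp
      commutes' := fun k => LinearMap.ext fun x => by
        rw [Module.algebraMap_end_apply, hsmulV, halgB]
        rfl }
  have hβE : ∀ (b : B) (x : V), βE b x = D.ρ b x := fun _ _ => rfl
  let γE : D.C →ₐ[K] Module.End K V :=
    { toFun := fun c =>
        { toFun := fun x => (c : Module.End ℚ V) x
          map_add' := fun x y => map_add _ x y
          map_smul' := fun k x => hcK c k x }
      map_one' := LinearMap.ext fun x => rfl
      map_mul' := fun a b => LinearMap.ext fun x => rfl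
      map_zero' := LinearMap.ext fun x => rfl
      map_add' := fun a b => LinearMap.ext fun x => rfl
      commutes' := fun k => LinearMap.ext fun x => by
        rw [Module.algebraMap_end_apply, hsmulV, halgC]
        rfl }
  have hγE : ∀ (c : D.C) (x : V), γE c x = (c : Module.End ℚ V) x := fun _ _ => rfl
  have hcommE : ∀ (b : B) (c : D.C), βE b * γE c = γE c * βE b := fun b c => by
    apply LinearMap.ext
    intro x
    have hc := (Subalgebra.mem_centralizer_iff ℚ).1 c.2 (D.ρ b) ⟨_, rfl⟩
    rw [Module.End.mul_apply, Module.End.mul_apply, hβE, hγE, hβE, hγE, ← Module.End.mul_apply, hc,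
      Module.End.mul_apply]
  set N : ℕ := finrank K V with hNdef
  let bV := Module.finBasis K V
  let toMat : Module.End K V ≃ₐ[K] Matrix (Fin N) (Fin N) K := LinearMap.toMatrixAlgEquiv bV
  let βM : B →ₐ[K] Matrix (Fin N) (Fin N) K := toMat.toAlgHom.comp βE
  let γM : D.C →ₐ[K] Matrix (Fin N) (Fin N) K := toMat.toAlgHom.comp γE
  have hcomm : ∀ b c, βM b * γM c = γM c * βM b := fun b c => by
    change toMat (βE b) * toMat (γE c) = toMat (γE c) * toMat (βE b)
    rw [← map_mul, hcommE, map_mul]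
  -- the double-centralizer count in `End_ℚ(V)`, read over `K`
  haveI : IsSimpleRing (Module.End ℚ V) := isSimpleRing_moduleEnd
  have hQ : finrank ℚ B * finrank ℚ D.C = finrank ℚ V * finrank ℚ V := by
    rw [← Module.finrank_linearMap (R := ℚ) (S := ℚ) (M := V) (N := V)]
    exact finrank_mul_finrank_centralizer_range D.ρ
  have hdim : finrank K B * finrank K D.C = N * N := by
    apply Nat.eq_of_mul_eq_mul_left (Nat.mul_pos hK0 hK0)
    have hV : finrank ℚ V = finrank ℚ K * N := (Module.finrank_mul_finrank ℚ K V).symm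
    have hC : finrank ℚ D.C = finrank ℚ K * finrank K D.C := (Module.finrank_mul_finrank ℚ K D.C).symm
    rw [htowerB, hC, hV] at hQ
    calc finrank ℚ K * finrank ℚ K * (finrank K B * finrank K ↥D.C)
        = finrank ℚ K * finrank K B * (finrank ℚ K * finrank K ↥D.C) := by ring
      _ = finrank ℚ K * N * (finrank ℚ K * N) := hQ
      _ = finrank ℚ K * finrank ℚ K * (N * N) := by ring
  /- §7 every real place: `C_σ ≅ M_n(ℍ)`, `4n² = [C:K]`, with a real model -/
  have place : ∀ σ : K →+* ℝ, ∃ b : ℕ, b ≠ 0 ∧ finrank K D.C = 4 * (b * b) ∧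
      ∃ j : D.C →ₐ[ℚ] Matrix (Fin b) (Fin b) ℍ[ℝ], IsRealModel K σ j := fun σ => by
    letI : Algebra K ℝ := σ.toAlgebra
    exact exists_realModel_quaternion_of_symplecticType hpos ιK hιK hdK hs βM γM hcomm hdim
  obtain ⟨w₀⟩ := (inferInstance : Nonempty (InfinitePlace K))
  obtain ⟨n, hn0, hCn, -⟩ := place (w₀.embedding_of_isReal (IsTotallyReal.isReal w₀))
  have hmodels : ∀ w : InfinitePlace K, ∃ j : D.C →ₐ[ℚ] Matrix (Fin n) (Fin n) ℍ[ℝ],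
      IsRealModel K (w.embedding_of_isReal (IsTotallyReal.isReal w)) j := fun w => by
    obtain ⟨b, -, hCb, j, hj⟩ := place (w.embedding_of_isReal (IsTotallyReal.isReal w))
    have hbn : b = n := Nat.mul_self_inj.mp (by
      have h := hCb.symm.trans hCn
      omega)
    subst hbn
    exact ⟨j, hj⟩
  choose j hj using hmodels
  /- §8 glue over the places and reindex by `Fin [F₀ : ℚ]` -/
  obtain ⟨Φ, -⟩ := exists_algEquiv_pi_of_realModels (K := K) (F := D.C) (A := Matrix (Fin n) (Fin n) ℍ[ℝ]) hj
  have hF0 : finrank ℚ (F0 B) = finrank ℚ Z := by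
    have hF : F0 B = Subalgebra.toSubmodule Z := by
      change Subalgebra.toSubmodule (Subalgebra.center ℚ B) ⊓ selfAdjoint.submodule ℚ B = Subalgebra.toSubmodule Z
      exact inf_eq_left.mpr fun x hx => (selfAdjoint.mem_iff (x := x)).mpr (hfix x hx)
    rw [hF, Subalgebra.finrank_toSubmodule]
  have hcard : Fintype.card (InfinitePlace K) = finrank ℚ (F0 B) := by
    rw [hF0, ← hKZ, IsTotallyReal.finrank (K := K), InfinitePlace.card_eq_nrRealPlaces_add_nrComplexPlaces,
      IsTotallyReal.nrComplexPlaces_eq_zero, add_zero]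
  let ε : InfinitePlace K ≃ Fin (finrank ℚ (F0 B)) := Fintype.equivFinOfCardEq hcard
  have hdimC : finrank ℚ D.C = (2 * n) ^ 2 * finrank ℚ (Subalgebra.center ℚ B) := by
    rw [← Module.finrank_mul_finrank ℚ K D.C, hKZ, hCn, ← hZdef]
    ring
  exact ⟨n, Nat.pos_of_ne_zero hn0, hdimC,
    ⟨Φ.trans (AlgEquiv.piCongrLeft' ℝ (fun _ : InfinitePlace K => Matrix (Fin n) (Fin n) ℍ[ℝ]) ε)⟩⟩

end Literature.NumberTheory.Kottwitz1992.ModuliProblem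

end
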